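import Summits.CriticalPhenomena.PercolationContinuityZ3.Theorems.Transplant.FKConnectivityAllQAntipodalWiredGluing
import Summits.CriticalPhenomena.PercolationContinuityZ3.Theorems.Transplant.FKConnectivityAllQAntipodalX2SpineExtract
import HarnessLib

/-!
# Connectivity correlation inequalities for `φ_{w,q}` — THEOREM U WITH A WIRED MARKED EDGE: `apUpcW ≥ 0` on two-terminal series–parallel
# networks for every `q > 0` (Theorem U for the contraction `M/z`)

Theorem file (`--supports stmt-CriticalPhenomena-4575`), FK sub-lane `prim-bschramm-fk-2` (gen 14); builds on p205010 (kernel theorem,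
internal audit signed; external expert review pending).  No definitions, no named facts, no sorries; standard axioms.

`apUpcW q T s t u v h = ∑_{C ⊆ T} q^{k(C∪z)+k((T∖C)∪z)} (1{s↔t in C∪z} - 1{s↔t in (T∖C)∪z}) h(C)` (`…AntipodalWiredDefs`).  With the pointwise
gluing identities for a GENERAL pair of configurations on the marked side (`…AntipodalWiredGluing`), `apUpcW` of a
composite with an unmarked two-terminal series–parallel part is a nonnegative combination of `apUpcW` of the marked part (on sections) and
`apUpc` of the unmarked part (`FK.apUpcW_parallel_nonneg`, `FK.apUpcW_series_left/right_nonneg`); along the spine of the marked edge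
(`FK.IsSpine`, base `apUpcW ∅ = 0`) this gives **`FK.apUpcW_nonneg_of_isTTSP`**: for `E` TTSP between `s, t`, `uv ∈ E`, `T ⊆ E ∖ uv`, `q > 0`, `h`
monotone on the subsets of `T`, `0 ≤ apUpcW q T s t u v h` (memo g14 §5.7: the `q²`-term of the parallel twin).
[cite: Grimmett2006, §1.4 eq. (1.20) (p. 15); §3.8 Thm. (3.90) (pp. 61–62)]
-/

noncomputable section

namespace Summit.CriticalPhenomena.PercolationContinuityZ3.Theorems

namespace FK

open SimpleGraph Literature.Probability.LatticeModels Literature.Probability.Percolation X2Word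
open scoped Classical

variable {V : Type*} [Fintype V]

/-! ### Composition of the wired functional with an unmarked part -/

section Compose

variable {E₁ E₂ : Finset (Sym2 V)} {V₁ V₂ : Set V} {u v : V} {q : ℝ}

omit [Fintype V] in
/-- Wiring commutes with the split of a configuration over two parts (marked edge in the first part). [folklore] -/
theorem insert_union_split {z : Sym2 V} {T₁ T₂ C₁ γ₂ : Finset (Sym2 V)} (hd : Disjoint T₁ T₂) (hC₁ : C₁ ⊆ T₁) (hγ₂ : γ₂ ⊆ T₂) :
    insert z (C₁ ∪ γ₂) = insert z C₁ ∪ γ₂ ∧ insert z ((T₁ ∪ T₂) \ (C₁ ∪ γ₂)) = insert z (T₁ \ C₁) ∪ (T₂ \ γ₂) := by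
  refine ⟨(Finset.insert_union _ _ _).symm, ?_⟩
  rw [union_sdiff_union hd hC₁ hγ₂, Finset.insert_union]

omit [Fintype V] in
/-- Wiring commutes with the split (marked edge in the second part). [folklore] -/
theorem insert_union_split' {z : Sym2 V} {T₁ T₂ γ₁ C₂ : Finset (Sym2 V)} (hd : Disjoint T₁ T₂) (hγ₁ : γ₁ ⊆ T₁) (hC₂ : C₂ ⊆ T₂) :
    insert z (γ₁ ∪ C₂) = γ₁ ∪ insert z C₂ ∧ insert z ((T₁ ∪ T₂) \ (γ₁ ∪ C₂)) = (T₁ \ γ₁) ∪ insert z (T₂ \ C₂) := by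
  refine ⟨(Finset.union_insert _ _ _).symm, ?_⟩
  rw [union_sdiff_union hd hγ₁ hC₂, Finset.union_insert]

/-- **Parallel composition, marked edge in the first part**: `apUpcW(T₁ ⊔ T₂) ≥ 0` from `apUpcW(T₁; sections) ≥ 0` and Theorem U for the second
part (`q > 0`). [cite: Grimmett2006, §3.8 Thm. (3.90) (pp. 61–62)] -/
theorem apUpcW_parallel_nonneg {s t : V} (hq : 0 < q) (hd : Disjoint E₁ E₂) (h₁ : ∀ e ∈ (↑E₁ : Set (Sym2 V)), ∀ x ∈ e, x ∈ V₁)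
    (h₂ : ∀ e ∈ (↑E₂ : Set (Sym2 V)), ∀ x ∈ e, x ∈ V₂) (hS : V₁ ∩ V₂ ⊆ {s, t}) (hst : s ≠ t)
    {T₁ T₂ : Finset (Sym2 V)} (hT₁ : T₁ ⊆ E₁) (hT₂ : T₂ ⊆ E₂) (hz : s(u, v) ∈ E₁)
    (ih₁ : ∀ h' : Finset (Sym2 V) → ℝ, (∀ ⦃A B : Finset (Sym2 V)⦄, A ⊆ B → B ⊆ T₁ → h' A ≤ h' B) → 0 ≤ apUpcW q T₁ s t u v h')
    (ih₂ : ∀ h' : Finset (Sym2 V) → ℝ, (∀ ⦃A B : Finset (Sym2 V)⦄, A ⊆ B → B ⊆ T₂ → h' A ≤ h' B) → 0 ≤ apUpc q T₂ s t h')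
    {h : Finset (Sym2 V) → ℝ} (hmono : ∀ ⦃A B : Finset (Sym2 V)⦄, A ⊆ B → B ⊆ T₁ ∪ T₂ → h A ≤ h B) :
    0 ≤ apUpcW q (T₁ ∪ T₂) s t u v h := by
  have hdT : Disjoint T₁ T₂ := Finset.disjoint_of_subset_left hT₁ (Finset.disjoint_of_subset_right hT₂ hd)
  have hpos : 0 < q ^ (2 * Fintype.card V) := pow_pos hq _
  refine (mul_nonneg_iff_of_pos_left hpos).1 ?_
  unfold apUpcW
  rw [Finset.mul_sum, sum_powerset_union_disj hdT]
  -- rewrite every summand by the pointwise law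
  have hterm : ∀ C₁ ∈ T₁.powerset, ∀ γ₂ ∈ T₂.powerset,
      q ^ (2 * Fintype.card V) *
        (q ^ (clusterCount (↑(insert s(u, v) (C₁ ∪ γ₂)) : BondConfig V) ∅ +
            clusterCount (↑(insert s(u, v) ((T₁ ∪ T₂) \ (C₁ ∪ γ₂))) : BondConfig V) ∅) *
          ((apConn (insert s(u, v) (C₁ ∪ γ₂)) s t - apConn (insert s(u, v) ((T₁ ∪ T₂) \ (C₁ ∪ γ₂))) s t) * h (C₁ ∪ γ₂))) =
      q ^ apExp T₂ γ₂ *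
          (((1 - apConn γ₂ s t) * (1 - apConn (T₂ \ γ₂) s t) + q * ((1 - apConn γ₂ s t) * apConn (T₂ \ γ₂) s t)) *
            (q ^ (clusterCount (↑(insert s(u, v) C₁) : BondConfig V) ∅ + clusterCount (↑(insert s(u, v) (T₁ \ C₁)) : BondConfig V) ∅) *
              ((apConn (insert s(u, v) C₁) s t - apConn (insert s(u, v) (T₁ \ C₁)) s t) * h (C₁ ∪ γ₂)))) +
        q ^ (clusterCount (↑(insert s(u, v) C₁) : BondConfig V) ∅ + clusterCount (↑(insert s(u, v) (T₁ \ C₁)) : BondConfig V) ∅) *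
          (((1 - apConn (insert s(u, v) C₁) s t) * (1 - apConn (insert s(u, v) (T₁ \ C₁)) s t) +
              q * (apConn (insert s(u, v) C₁) s t * (1 - apConn (insert s(u, v) (T₁ \ C₁)) s t))) *
            (q ^ apExp T₂ γ₂ * ((apConn γ₂ s t - apConn (T₂ \ γ₂) s t) * h (C₁ ∪ γ₂)))) := by
    intro C₁ hC₁ γ₂ hγ₂
    rw [Finset.mem_powerset] at hC₁ hγ₂
    obtain ⟨e1, e2⟩ := insert_union_split (z := s(u, v)) hdT hC₁ hγ₂
    rw [e1, e2]
    exact ap_summand_parallel_gen q h₁ h₂ hS hst (Finset.insert_subset hz (hC₁.trans hT₁))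
      (Finset.insert_subset hz (Finset.sdiff_subset.trans hT₁)) hT₂ hγ₂ (h (C₁ ∪ γ₂))
  rw [Finset.sum_congr rfl fun C₁ hC₁ => Finset.sum_congr rfl fun γ₂ hγ₂ => hterm C₁ hC₁ γ₂ hγ₂]
  simp_rw [Finset.sum_add_distrib]
  rw [Finset.sum_comm]
  refine add_nonneg (Finset.sum_nonneg fun γ₂ hγ₂ => ?_) (Finset.sum_nonneg fun C₁ hC₁ => ?_)
  · -- the section `h(· ∪ γ₂)` against `apUpcW(T₁)`
    rw [Finset.mem_powerset] at hγ₂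
    have hc1 := apConn_le_one γ₂ s t
    have hd0 := apConn_nonneg (T₂ \ γ₂) s t
    have hd1 := apConn_le_one (T₂ \ γ₂) s t
    have hsum : ∑ C₁ ∈ T₁.powerset, q ^ apExp T₂ γ₂ *
        (((1 - apConn γ₂ s t) * (1 - apConn (T₂ \ γ₂) s t) + q * ((1 - apConn γ₂ s t) * apConn (T₂ \ γ₂) s t)) *
          (q ^ (clusterCount (↑(insert s(u, v) C₁) : BondConfig V) ∅ + clusterCount (↑(insert s(u, v) (T₁ \ C₁)) : BondConfig V) ∅) *
            ((apConn (insert s(u, v) C₁) s t - apConn (insert s(u, v) (T₁ \ C₁)) s t) * h (C₁ ∪ γ₂)))) =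
        q ^ apExp T₂ γ₂ *
          (((1 - apConn γ₂ s t) * (1 - apConn (T₂ \ γ₂) s t) + q * ((1 - apConn γ₂ s t) * apConn (T₂ \ γ₂) s t)) *
            apUpcW q T₁ s t u v (fun C₁ => h (C₁ ∪ γ₂))) := by
      simp only [apUpcW, Finset.mul_sum]
    rw [hsum]
    refine mul_nonneg (pow_nonneg hq.le _) (mul_nonneg ?_ (ih₁ _ fun A B hAB hB => ?_))
    · exact add_nonneg (mul_nonneg (sub_nonneg.2 hc1) (sub_nonneg.2 hd1)) (mul_nonneg hq.le (mul_nonneg (sub_nonneg.2 hc1) hd0))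
    · exact hmono (Finset.union_subset_union hAB le_rfl) (Finset.union_subset_union hB hγ₂)
  · rw [Finset.mem_powerset] at hC₁
    have hc0 := apConn_nonneg (insert s(u, v) C₁) s t
    have hc1 := apConn_le_one (insert s(u, v) C₁) s t
    have hd1 := apConn_le_one (insert s(u, v) (T₁ \ C₁)) s t
    have hsum : ∑ γ₂ ∈ T₂.powerset,
        q ^ (clusterCount (↑(insert s(u, v) C₁) : BondConfig V) ∅ + clusterCount (↑(insert s(u, v) (T₁ \ C₁)) : BondConfig V) ∅) *
          (((1 - apConn (insert s(u, v) C₁) s t) * (1 - apConn (insert s(u, v) (T₁ \ C₁)) s t) +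
              q * (apConn (insert s(u, v) C₁) s t * (1 - apConn (insert s(u, v) (T₁ \ C₁)) s t))) *
            (q ^ apExp T₂ γ₂ * ((apConn γ₂ s t - apConn (T₂ \ γ₂) s t) * h (C₁ ∪ γ₂)))) =
        q ^ (clusterCount (↑(insert s(u, v) C₁) : BondConfig V) ∅ + clusterCount (↑(insert s(u, v) (T₁ \ C₁)) : BondConfig V) ∅) *
          (((1 - apConn (insert s(u, v) C₁) s t) * (1 - apConn (insert s(u, v) (T₁ \ C₁)) s t) +
              q * (apConn (insert s(u, v) C₁) s t * (1 - apConn (insert s(u, v) (T₁ \ C₁)) s t))) *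
            apUpc q T₂ s t (fun γ₂ => h (C₁ ∪ γ₂))) := by
      simp only [apUpc, Finset.mul_sum]
    rw [hsum]
    refine mul_nonneg (pow_nonneg hq.le _) (mul_nonneg ?_ (ih₂ _ fun A B hAB hB => ?_))
    · exact add_nonneg (mul_nonneg (sub_nonneg.2 hc1) (sub_nonneg.2 hd1)) (mul_nonneg hq.le (mul_nonneg hc0 (sub_nonneg.2 hd1)))
    · exact hmono (Finset.union_subset_union le_rfl hAB) (Finset.union_subset_union hC₁ hB)

/-- **Series composition, marked edge in the `(a, m)`-part.** [cite: Grimmett2006, §3.8 Thm. (3.90) (pp. 61–62)] -/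
theorem apUpcW_series_left_nonneg {a m b : V} (hq : 0 < q) (hd : Disjoint E₁ E₂)
    (h₁ : ∀ e ∈ (↑E₁ : Set (Sym2 V)), ∀ x ∈ e, x ∈ V₁) (h₂ : ∀ e ∈ (↑E₂ : Set (Sym2 V)), ∀ x ∈ e, x ∈ V₂)
    (hS : V₁ ∩ V₂ ⊆ {m}) (haV₂ : a ∉ V₂) (hbV₁ : b ∉ V₁) (ham : a ≠ m) (hbm : b ≠ m) (hab : a ≠ b)
    {T₁ T₂ : Finset (Sym2 V)} (hT₁ : T₁ ⊆ E₁) (hT₂ : T₂ ⊆ E₂) (hz : s(u, v) ∈ E₁)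
    (ih₁ : ∀ h' : Finset (Sym2 V) → ℝ, (∀ ⦃A B : Finset (Sym2 V)⦄, A ⊆ B → B ⊆ T₁ → h' A ≤ h' B) → 0 ≤ apUpcW q T₁ a m u v h')
    (ih₂ : ∀ h' : Finset (Sym2 V) → ℝ, (∀ ⦃A B : Finset (Sym2 V)⦄, A ⊆ B → B ⊆ T₂ → h' A ≤ h' B) → 0 ≤ apUpc q T₂ m b h')
    {h : Finset (Sym2 V) → ℝ} (hmono : ∀ ⦃A B : Finset (Sym2 V)⦄, A ⊆ B → B ⊆ T₁ ∪ T₂ → h A ≤ h B) :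
    0 ≤ apUpcW q (T₁ ∪ T₂) a b u v h := by
  have hdT : Disjoint T₁ T₂ := Finset.disjoint_of_subset_left hT₁ (Finset.disjoint_of_subset_right hT₂ hd)
  have hpos : 0 < q ^ (2 * Fintype.card V) := pow_pos hq _
  refine (mul_nonneg_iff_of_pos_left hpos).1 ?_
  unfold apUpcW
  rw [Finset.mul_sum, sum_powerset_union_disj hdT]
  have hterm : ∀ C₁ ∈ T₁.powerset, ∀ γ₂ ∈ T₂.powerset,
      q ^ (2 * Fintype.card V) *
        (q ^ (clusterCount (↑(insert s(u, v) (C₁ ∪ γ₂)) : BondConfig V) ∅ +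
            clusterCount (↑(insert s(u, v) ((T₁ ∪ T₂) \ (C₁ ∪ γ₂))) : BondConfig V) ∅) *
          ((apConn (insert s(u, v) (C₁ ∪ γ₂)) a b - apConn (insert s(u, v) ((T₁ ∪ T₂) \ (C₁ ∪ γ₂))) a b) * h (C₁ ∪ γ₂))) =
      q ^ apExp T₂ γ₂ * (apConn (T₂ \ γ₂) m b *
          (q ^ (clusterCount (↑(insert s(u, v) C₁) : BondConfig V) ∅ + clusterCount (↑(insert s(u, v) (T₁ \ C₁)) : BondConfig V) ∅) *
            ((apConn (insert s(u, v) C₁) a m - apConn (insert s(u, v) (T₁ \ C₁)) a m) * h (C₁ ∪ γ₂)))) +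
        q ^ (clusterCount (↑(insert s(u, v) C₁) : BondConfig V) ∅ + clusterCount (↑(insert s(u, v) (T₁ \ C₁)) : BondConfig V) ∅) *
          (apConn (insert s(u, v) C₁) a m * (q ^ apExp T₂ γ₂ * ((apConn γ₂ m b - apConn (T₂ \ γ₂) m b) * h (C₁ ∪ γ₂)))) := by
    intro C₁ hC₁ γ₂ hγ₂
    rw [Finset.mem_powerset] at hC₁ hγ₂
    obtain ⟨e1, e2⟩ := insert_union_split (z := s(u, v)) hdT hC₁ hγ₂
    rw [e1, e2]
    exact ap_summand_series_gen q h₁ h₂ hS haV₂ hbV₁ ham hbm hab (Finset.insert_subset hz (hC₁.trans hT₁))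
      (Finset.insert_subset hz (Finset.sdiff_subset.trans hT₁)) hT₂ hγ₂ (h (C₁ ∪ γ₂))
  rw [Finset.sum_congr rfl fun C₁ hC₁ => Finset.sum_congr rfl fun γ₂ hγ₂ => hterm C₁ hC₁ γ₂ hγ₂]
  simp_rw [Finset.sum_add_distrib]
  rw [Finset.sum_comm]
  refine add_nonneg (Finset.sum_nonneg fun γ₂ hγ₂ => ?_) (Finset.sum_nonneg fun C₁ hC₁ => ?_)
  · rw [Finset.mem_powerset] at hγ₂
    have hsum : ∑ C₁ ∈ T₁.powerset, q ^ apExp T₂ γ₂ * (apConn (T₂ \ γ₂) m b *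
        (q ^ (clusterCount (↑(insert s(u, v) C₁) : BondConfig V) ∅ + clusterCount (↑(insert s(u, v) (T₁ \ C₁)) : BondConfig V) ∅) *
          ((apConn (insert s(u, v) C₁) a m - apConn (insert s(u, v) (T₁ \ C₁)) a m) * h (C₁ ∪ γ₂)))) =
        q ^ apExp T₂ γ₂ * (apConn (T₂ \ γ₂) m b * apUpcW q T₁ a m u v (fun C₁ => h (C₁ ∪ γ₂))) := by
      simp only [apUpcW, Finset.mul_sum]
    rw [hsum]
    refine mul_nonneg (pow_nonneg hq.le _) (mul_nonneg (apConn_nonneg _ _ _) (ih₁ _ fun A B hAB hB => ?_))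
    exact hmono (Finset.union_subset_union hAB le_rfl) (Finset.union_subset_union hB hγ₂)
  · rw [Finset.mem_powerset] at hC₁
    have hsum : ∑ γ₂ ∈ T₂.powerset,
        q ^ (clusterCount (↑(insert s(u, v) C₁) : BondConfig V) ∅ + clusterCount (↑(insert s(u, v) (T₁ \ C₁)) : BondConfig V) ∅) *
          (apConn (insert s(u, v) C₁) a m * (q ^ apExp T₂ γ₂ * ((apConn γ₂ m b - apConn (T₂ \ γ₂) m b) * h (C₁ ∪ γ₂)))) =
        q ^ (clusterCount (↑(insert s(u, v) C₁) : BondConfig V) ∅ + clusterCount (↑(insert s(u, v) (T₁ \ C₁)) : BondConfig V) ∅) *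
          (apConn (insert s(u, v) C₁) a m * apUpc q T₂ m b (fun γ₂ => h (C₁ ∪ γ₂))) := by
      simp only [apUpc, Finset.mul_sum]
    rw [hsum]
    refine mul_nonneg (pow_nonneg hq.le _) (mul_nonneg (apConn_nonneg _ _ _) (ih₂ _ fun A B hAB hB => ?_))
    exact hmono (Finset.union_subset_union le_rfl hAB) (Finset.union_subset_union hC₁ hB)

/-- **Series composition, marked edge in the `(m, b)`-part.** [cite: Grimmett2006, §3.8 Thm. (3.90) (pp. 61–62)] -/
theorem apUpcW_series_right_nonneg {a m b : V} (hq : 0 < q) (hd : Disjoint E₁ E₂)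
    (h₁ : ∀ e ∈ (↑E₁ : Set (Sym2 V)), ∀ x ∈ e, x ∈ V₁) (h₂ : ∀ e ∈ (↑E₂ : Set (Sym2 V)), ∀ x ∈ e, x ∈ V₂)
    (hS : V₁ ∩ V₂ ⊆ {m}) (haV₂ : a ∉ V₂) (hbV₁ : b ∉ V₁) (ham : a ≠ m) (hbm : b ≠ m) (hab : a ≠ b)
    {T₁ T₂ : Finset (Sym2 V)} (hT₁ : T₁ ⊆ E₁) (hT₂ : T₂ ⊆ E₂) (hz : s(u, v) ∈ E₂)
    (ih₁ : ∀ h' : Finset (Sym2 V) → ℝ, (∀ ⦃A B : Finset (Sym2 V)⦄, A ⊆ B → B ⊆ T₁ → h' A ≤ h' B) → 0 ≤ apUpc q T₁ a m h')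
    (ih₂ : ∀ h' : Finset (Sym2 V) → ℝ, (∀ ⦃A B : Finset (Sym2 V)⦄, A ⊆ B → B ⊆ T₂ → h' A ≤ h' B) → 0 ≤ apUpcW q T₂ m b u v h')
    {h : Finset (Sym2 V) → ℝ} (hmono : ∀ ⦃A B : Finset (Sym2 V)⦄, A ⊆ B → B ⊆ T₁ ∪ T₂ → h A ≤ h B) :
    0 ≤ apUpcW q (T₁ ∪ T₂) a b u v h := by
  have hdT : Disjoint T₁ T₂ := Finset.disjoint_of_subset_left hT₁ (Finset.disjoint_of_subset_right hT₂ hd)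
  have hpos : 0 < q ^ (2 * Fintype.card V) := pow_pos hq _
  refine (mul_nonneg_iff_of_pos_left hpos).1 ?_
  unfold apUpcW
  rw [Finset.mul_sum, sum_powerset_union_disj hdT]
  have hterm : ∀ γ₁ ∈ T₁.powerset, ∀ C₂ ∈ T₂.powerset,
      q ^ (2 * Fintype.card V) *
        (q ^ (clusterCount (↑(insert s(u, v) (γ₁ ∪ C₂)) : BondConfig V) ∅ +
            clusterCount (↑(insert s(u, v) ((T₁ ∪ T₂) \ (γ₁ ∪ C₂))) : BondConfig V) ∅) *
          ((apConn (insert s(u, v) (γ₁ ∪ C₂)) a b - apConn (insert s(u, v) ((T₁ ∪ T₂) \ (γ₁ ∪ C₂))) a b) * h (γ₁ ∪ C₂))) =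
      q ^ (clusterCount (↑(insert s(u, v) C₂) : BondConfig V) ∅ + clusterCount (↑(insert s(u, v) (T₂ \ C₂)) : BondConfig V) ∅) *
          (apConn (insert s(u, v) (T₂ \ C₂)) m b * (q ^ apExp T₁ γ₁ * ((apConn γ₁ a m - apConn (T₁ \ γ₁) a m) * h (γ₁ ∪ C₂)))) +
        q ^ apExp T₁ γ₁ * (apConn γ₁ a m *
          (q ^ (clusterCount (↑(insert s(u, v) C₂) : BondConfig V) ∅ + clusterCount (↑(insert s(u, v) (T₂ \ C₂)) : BondConfig V) ∅) *
            ((apConn (insert s(u, v) C₂) m b - apConn (insert s(u, v) (T₂ \ C₂)) m b) * h (γ₁ ∪ C₂)))) := by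
    intro γ₁ hγ₁ C₂ hC₂
    rw [Finset.mem_powerset] at hγ₁ hC₂
    obtain ⟨e1, e2⟩ := insert_union_split' (z := s(u, v)) hdT hγ₁ hC₂
    rw [e1, e2]
    exact ap_summand_series_gen' q h₁ h₂ hS haV₂ hbV₁ ham hbm hab hT₁ hγ₁ (Finset.insert_subset hz (hC₂.trans hT₂))
      (Finset.insert_subset hz (Finset.sdiff_subset.trans hT₂)) (h (γ₁ ∪ C₂))
  rw [Finset.sum_congr rfl fun γ₁ hγ₁ => Finset.sum_congr rfl fun C₂ hC₂ => hterm γ₁ hγ₁ C₂ hC₂]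
  simp_rw [Finset.sum_add_distrib]
  rw [Finset.sum_comm]
  refine add_nonneg (Finset.sum_nonneg fun C₂ hC₂ => ?_) (Finset.sum_nonneg fun γ₁ hγ₁ => ?_)
  · rw [Finset.mem_powerset] at hC₂
    have hsum : ∑ γ₁ ∈ T₁.powerset,
        q ^ (clusterCount (↑(insert s(u, v) C₂) : BondConfig V) ∅ + clusterCount (↑(insert s(u, v) (T₂ \ C₂)) : BondConfig V) ∅) *
          (apConn (insert s(u, v) (T₂ \ C₂)) m b * (q ^ apExp T₁ γ₁ * ((apConn γ₁ a m - apConn (T₁ \ γ₁) a m) * h (γ₁ ∪ C₂)))) =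
        q ^ (clusterCount (↑(insert s(u, v) C₂) : BondConfig V) ∅ + clusterCount (↑(insert s(u, v) (T₂ \ C₂)) : BondConfig V) ∅) *
          (apConn (insert s(u, v) (T₂ \ C₂)) m b * apUpc q T₁ a m (fun γ₁ => h (γ₁ ∪ C₂))) := by
      simp only [apUpc, Finset.mul_sum]
    rw [hsum]
    refine mul_nonneg (pow_nonneg hq.le _) (mul_nonneg (apConn_nonneg _ _ _) (ih₁ _ fun A B hAB hB => ?_))
    exact hmono (Finset.union_subset_union hAB le_rfl) (Finset.union_subset_union hB hC₂)
  · rw [Finset.mem_powerset] at hγ₁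
    have hsum : ∑ C₂ ∈ T₂.powerset, q ^ apExp T₁ γ₁ * (apConn γ₁ a m *
        (q ^ (clusterCount (↑(insert s(u, v) C₂) : BondConfig V) ∅ + clusterCount (↑(insert s(u, v) (T₂ \ C₂)) : BondConfig V) ∅) *
          ((apConn (insert s(u, v) C₂) m b - apConn (insert s(u, v) (T₂ \ C₂)) m b) * h (γ₁ ∪ C₂)))) =
        q ^ apExp T₁ γ₁ * (apConn γ₁ a m * apUpcW q T₂ m b u v (fun C₂ => h (γ₁ ∪ C₂))) := by
      simp only [apUpcW, Finset.mul_sum]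
    rw [hsum]
    refine mul_nonneg (pow_nonneg hq.le _) (mul_nonneg (apConn_nonneg _ _ _) (ih₂ _ fun A B hAB hB => ?_))
    exact hmono (Finset.union_subset_union le_rfl hAB) (Finset.union_subset_union hγ₁ hB)

end Compose

/-! ### Along the spine of the marked edge -/

section Spine

variable {q : ℝ} {u v : V}

/-- **`apUpcW ≥ 0` propagates along a spine** from an inner composite `(M; a, b) ∋ z` to every network grown from it. [folklore] -/
theorem IsSpine.apUpcW_nonneg (hq : 0 < q) {ps : List (SpinePart V)} {M E : Finset (Sym2 V)} {a b s t : V}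
    (hsp : IsSpine ps M a b E s t) (hab : a ≠ b) (hz : s(u, v) ∈ M)
    (core : ∀ T ⊆ M.erase s(u, v), ∀ h' : Finset (Sym2 V) → ℝ,
      (∀ ⦃A B : Finset (Sym2 V)⦄, A ⊆ B → B ⊆ T → h' A ≤ h' B) → 0 ≤ apUpcW q T a b u v h') :
    ∀ T ⊆ E.erase s(u, v), ∀ h : Finset (Sym2 V) → ℝ,
      (∀ ⦃A B : Finset (Sym2 V)⦄, A ⊆ B → B ⊆ T → h A ≤ h B) → 0 ≤ apUpcW q T s t u v h := by
  induction ps generalizing M a b with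
  | nil =>
    obtain ⟨rfl, rfl, rfl⟩ := hsp
    exact core
  | cons p ps ih =>
    obtain ⟨a', b', hg, hrest⟩ := hsp
    refine ih hrest (hg.ne hab) (Finset.mem_union_left _ hz) ?_
    intro T hT h hmono
    have hzR : s(u, v) ∉ p.R := fun hh => Finset.disjoint_left.1 hg.disjoint hz hh
    -- split `T` over the two parts
    have hTeq : T = T ∩ M ∪ T ∩ p.R := by
      rw [← Finset.inter_union_distrib_left, Finset.inter_eq_left.2 ((Finset.erase_subset _ _).trans' hT |>.trans (by rfl))]
    have hT₁ : T ∩ M ⊆ M.erase s(u, v) := fun e he => by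
      rw [Finset.mem_erase]; exact ⟨Finset.ne_of_mem_erase (hT (Finset.mem_inter.1 he).1), (Finset.mem_inter.1 he).2⟩
    have hT₂ : T ∩ p.R ⊆ p.R := Finset.inter_subset_right
    rw [hTeq] at hmono ⊢
    cases hg with
    | @par M R a b hR hd hV =>
      exact apUpcW_parallel_nonneg hq hd (span_mem M) (span_mem R) (inter_span_subset_pair hV) hab
        Finset.inter_subset_right hT₂ hz (core _ hT₁) (apUpc_nonneg_of_isTTSP hq hR _ hT₂) hmono
    | @serA M R a b a' hR hd hV hb ha' =>
      have hS : {w : V | ∃ e ∈ R, w ∈ e} ∩ {w : V | ∃ e ∈ M, w ∈ e} ⊆ ({a} : Set V) := fun w hw => hV w hw.2 hw.1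
      have ha'b : a' ≠ b := (ne_of_not_mem_span hb hR.right_mem).symm
      rw [Finset.union_comm] at hmono ⊢
      exact apUpcW_series_right_nonneg hq hd.symm (span_mem R) (span_mem M) hS
        (fun hh => by obtain ⟨e, he, hh⟩ := hh; exact ha' e he hh) (fun hh => by obtain ⟨e, he, hh⟩ := hh; exact hb e he hh)
        hR.ne.symm hab.symm ha'b hT₂ Finset.inter_subset_right hz (apUpc_nonneg_of_isTTSP hq hR.symm _ hT₂) (core _ hT₁) hmono
    | @serB M R a b b' hR hd hV ha hb' =>
      have hS : {w : V | ∃ e ∈ M, w ∈ e} ∩ {w : V | ∃ e ∈ R, w ∈ e} ⊆ ({b} : Set V) := fun w hw => hV w hw.1 hw.2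
      have hab' : a ≠ b' := ne_of_not_mem_span ha hR.right_mem
      exact apUpcW_series_left_nonneg hq hd (span_mem M) (span_mem R) hS
        (fun hh => by obtain ⟨e, he, hh⟩ := hh; exact ha e he hh) (fun hh => by obtain ⟨e, he, hh⟩ := hh; exact hb' e he hh)
        hab hR.ne.symm hab' Finset.inter_subset_right hT₂ hz (core _ hT₁) (apUpc_nonneg_of_isTTSP hq hR _ hT₂) hmono

omit [Fintype V] in
/-- `apUpcW` is symmetric in the marked pair. [folklore] -/
theorem apUpcW_swap (q : ℝ) (T : Finset (Sym2 V)) (s t u v : V) (h : Finset (Sym2 V) → ℝ) :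
    apUpcW q T s t v u h = apUpcW q T s t u v h := by
  unfold apUpcW; rw [Sym2.eq_swap]

/-- **THEOREM (Theorem U with a wired marked edge, every `q > 0`).**  For `E` two-terminal series–parallel between `s, t`, `uv ∈ E`,
`T ⊆ E ∖ uv`, `q > 0` and `h` monotone on the subsets of `T`: `0 ≤ apUpcW q T s t u v h` — Theorem U for the contraction `E/uv`.
[cite: Grimmett2006, §3.8 Thm. (3.90) (pp. 61–62)] -/
theorem apUpcW_nonneg_of_isTTSP (hq : 0 < q) {E T : Finset (Sym2 V)} {s t : V} (hE : IsTTSP E s t) (huv : s(u, v) ∈ E)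
    (hT : T ⊆ E.erase s(u, v)) {h : Finset (Sym2 V) → ℝ} (hmono : ∀ ⦃A B : Finset (Sym2 V)⦄, A ⊆ B → B ⊆ T → h A ≤ h B) :
    0 ≤ apUpcW q T s t u v h := by
  have hne : u ≠ v := fun hh => hE.not_isDiag huv (Sym2.mk_isDiag_iff.2 hh)
  have core : ∀ {x y : V}, ∀ T' ⊆ ({s(x, y)} : Finset (Sym2 V)).erase s(x, y), ∀ h' : Finset (Sym2 V) → ℝ,
      (∀ ⦃A B : Finset (Sym2 V)⦄, A ⊆ B → B ⊆ T' → h' A ≤ h' B) → 0 ≤ apUpcW q T' x y x y h' := by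
    intro x y T' hT' h' _
    rw [Finset.erase_singleton] at hT'
    rw [Finset.subset_empty.1 hT', apUpcW_empty]
  obtain ⟨ps, hsp | hsp⟩ := exists_spine hE huv
  · exact hsp.apUpcW_nonneg hq hne (Finset.mem_singleton_self _) core T hT h hmono
  · rw [← apUpcW_swap]
    rw [Sym2.eq_swap] at hsp hT
    exact hsp.apUpcW_nonneg hq hne.symm (Finset.mem_singleton_self _) core T hT h hmono

end Spine

end FK

end Summit.CriticalPhenomena.PercolationContinuityZ3.Theorems

end
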